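import Mathlib.Data.Real.Basic
import Mathlib.Tactic.Linarith
import Mathlib.Tactic.Positivity
import Mathlib.Tactic.Ring

/-!
# FunctionalMining/NoGo — the scalar kernel of THEOREM N19 (b): `EPhi.q=2.RQ.j=1` is immune to compressed-everywhere fields (nogo; filed p228874)

HONEST FRAMING. Search for candidate a priori estimates; no regularity claim. NS FUNCTIONAL MINING —
NO-GO BRANCH (cell `pub-nsfunc`). Nothing about Navier–Stokes is proved here. The no-go branch's THEOREM N19 (b)
(NOGO.md, SIEVEZ0.md Remark 7) says: for `F = ∫|ω|² log(e + |ω|/Ω)`, `Ω = νZ/K`, and a smooth divergence-free field with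
`α = ξ·Sξ ≤ 0` everywhere and `σ ≢ 0`, the full Navier–Stokes derivative `dF/dt = N + V₁ + V₂` is negative, where — writing
`Aσ = ∫|σ| > 0`, `G = ‖∇ω‖² ≥ 0`, `ℓσ ≥ 1` / `ρσ ≥ 0` for the `|σ|`-averages of `log(e + r)` / `r/(e + r)` and `ρZ ∈ [0, 1)` for the
`|ω|²`-average of `r/(e + r)` — the calculus part of the proof (vorticity equation, integration by parts, `Z² ≤ 2K‖∇ω‖²`)
delivers exactly the four scalar facts
  `N = −Aσ (2ℓσ + ρσ) + 2 Aσ ρZ`,  `V₁ ≤ −2νG`,  `V₂ ≤ 2νG·ρZ` (and `V₂ ≥ 0`, not needed).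
This file checks the remaining arithmetic: those facts force `N + V₁ + V₂ < 0` (and `N < 0` on its own: the Euler statement).
The analytic inputs are documented hypotheses, to be formalised (or cited) by the prove seat; they are NOT asserted here. [ours]
-/

namespace Summit.NavierStokesRegularity.FunctionalMining.NoGo.EPhiImmune

/-- Euler part of N19 (b): the inviscid production of `EPhi.q=2.RQ.j=1` on a compressed-everywhere field is negative. [ours] -/
theorem euler_production_neg (Aσ ℓσ ρσ ρZ N : ℝ) (hA : 0 < Aσ) (hℓ : 1 ≤ ℓσ) (hρσ : 0 ≤ ρσ) (hρZ : ρZ < 1)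
    (hN : N = -Aσ * (2 * ℓσ + ρσ) + 2 * Aσ * ρZ) : N < 0 := by
  have h1 : Aσ * (2 * ℓσ + ρσ) ≥ 2 * Aσ := by nlinarith
  have h2 : 2 * Aσ * ρZ < 2 * Aσ := by nlinarith
  linarith

/-- Full N19 (b): with the viscous bounds `V₁ ≤ −2νG` and `V₂ ≤ 2νG ρZ` the Navier–Stokes derivative is negative as well. [ours] -/
theorem ns_derivative_neg (Aσ ℓσ ρσ ρZ N ν G V₁ V₂ : ℝ) (hA : 0 < Aσ) (hℓ : 1 ≤ ℓσ) (hρσ : 0 ≤ ρσ)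
    (hρZ : ρZ < 1) (hν : 0 < ν) (hG : 0 ≤ G)
    (hN : N = -Aσ * (2 * ℓσ + ρσ) + 2 * Aσ * ρZ) (hV₁ : V₁ ≤ -2 * ν * G) (hV₂ : V₂ ≤ 2 * ν * G * ρZ) :
    N + V₁ + V₂ < 0 := by
  have hN' : N < 0 := euler_production_neg Aσ ℓσ ρσ ρZ N hA hℓ hρσ hρZ hN
  have h1 : 0 ≤ 1 - ρZ := by linarith
  have hV : V₁ + V₂ ≤ -(2 * ν * G * (1 - ρZ)) := by nlinarith
  have hV' : 0 ≤ 2 * ν * G * (1 - ρZ) := by positivity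
  linarith

/-- The neutral case `σ ≡ 0` (`N = 0`): viscosity alone still gives a strictly negative derivative as soon as
`‖∇ω‖² > 0`, i.e. for every non-constant (= every non-zero mean-free) vorticity. [ours] -/
theorem ns_derivative_neg_of_neutral (ρZ ν G V₁ V₂ : ℝ) (hρZ : ρZ < 1) (hν : 0 < ν) (hG : 0 < G)
    (hV₁ : V₁ ≤ -2 * ν * G) (hV₂ : V₂ ≤ 2 * ν * G * ρZ) : V₁ + V₂ < 0 := by
  have h1 : 0 < 1 - ρZ := by linarith
  have : V₁ + V₂ ≤ -(2 * ν * G * (1 - ρZ)) := by nlinarith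
  have h2 : 0 < 2 * ν * G * (1 - ρZ) := by positivity
  linarith

end Summit.NavierStokesRegularity.FunctionalMining.NoGo.EPhiImmune
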